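import Summits.ResolutionOfSingularities.ResolutionOfSingularities.Theorems.FrobeniusLadderFInjectiveMacaulayficationFullCentreDescentRegular
import Summits.ResolutionOfSingularities.ResolutionOfSingularities.Theorems.FrobeniusLadderFInjectiveMacaulayficationTrFullStepDoor
import Summits.ResolutionOfSingularities.ResolutionOfSingularities.Theorems.FrobeniusLadderFInjectiveMacaulayficationIntrinsicTowerRecipes
import Summits.ResolutionOfSingularities.ResolutionOfSingularities.Theorems.FrobeniusLadderFInjectiveMacaulayficationRegularBlowupModelDim2
import Literature.AlgebraicGeometry.Resolution.Temkin2008Localization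
import HarnessLib

/-!
# «RR» — THE REGULARIZING INTRINSIC TOWER: a KILLABLE canonical-process form of the T-HALF T″(p,e,r) of door v41, recipe-parametric, with its kernel bridge PROVED
# (crux `FInjectiveMacaulayfication` stmt-ResolutionOfSingularities-15315, chain w45a; res-L1-w45a-lead-1 g9 — OFFER ADOPTED by res-L1-w45a-plan-1 RULINGS R19.8 / R19.8a
# as THE (RR-K) FILE of programme «RR» (the desk's parallel sig `L/w45a/SingTowerSig.lean` 0991a6b185eb4b2c, same mathematics typed independently, stays desk evidence);
# no door change — v41 `Lines/step_door.lean` 554affabf0e9e2f3 STAYS of record; the T-side twin of the desk's «TT» v2 `L/w45a/TauTowerSig.lean` 1c471f18f0788d50)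

[OURS · L1 W4.5a] Support file (`--supports stmt-ResolutionOfSingularities-15315 --as helper`); NOT a statement of any manuscript; fact-free; the conjecture is OURS,
consumed only as a hypothesis. AI-written (AI review is weaker than expert review).

WHY. Door v41's T-half `TrFullStep.LocalRegularizationFibreFullTr p e 1` (at a closed singular FULL germ of an `e`-fold over `k(s)`, every FULL admissible modification `S′`
regular off the closed fibre admits a fibre-supported centre all of whose blowings up are REGULAR) is, like the F-half, an ∃-statement no computation can refute. The TT
programme replaced the F-half by «a canonical Sing-supported centre tower terminates FULL» (killable; kernel bridge `FullCentreDescent.exists_fullCentre_of_tower_of_regularOff`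
✓ p632502 → stub-2's `IntrinsicTower.Recipes`). This file does THE SAME FOR THE T-HALF, with the regularity instance `FullCentreDescent.exists_regularCentre_of_tower` (✓ p632502):
* `TowerRegular c p n S` := EVERY chain of `n` blowing ups, each along the recipe's centre `c p` of the floor below, starting at `S`, ends REGULAR at every point;
* `RegTowerTerminates c p e r` := T″(p,e,r)'s binders VERBATIM, conclusion `∃ n, TowerRegular c p n S′` — KILLABLE per recipe by ONE admissible FULL floor whose `c`-tower loops
  (kernel shape `FullCentreDescent.not_exists_tower_of_persistent` with `Q` := regularity);
* the recipe `singCentre` := the reduced (vanishing) ideal sheaf of the closure of the singular locus («blow up Sing_red, repeat») and `@[conjecture] SingTowerConjecture p e r :=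
  RegTowerTerminates singCentre p e r` — ONE candidate recipe; the statement of value is recipe-parametric;
* ★ `tStep_of_regTowerTerminates (c) (hc : Sing-supported) : RegTowerTerminates c p e r → LocalRegularizationFibreFullTr p e r` — PROVED (closed fibre `F` of `S′ → Spec 𝒪_{Y,y}`:
  closed; misses a preimage of the generic point, which is regular hence off `supp I ⊆ (Reg)ᶜ` and is not the closed point since `y ∉ Reg Y`; `S′` regular off `F` by the binder;
  then `exists_regularCentre_of_tower`); hence door terms ★ `fInjectiveMacaulayfication_of_prints_of_LFadmF_of_regTower` (crux ⟸ four prints ∧ F-half ∧ (RR at r = 1, e ≥ 4,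
  any ONE Sing-supported recipe)) and its `singCentre` instance, and ★ the TWIN-TOWERS door term `fInjectiveMacaulayfication_of_prints_of_twinTowers` (crux ⟸ four prints ∧ `TauTowerConjecture` ∧ RR-Sing at
  r = 1; line v43, by evidence) — audit: `proof.conditional` of the crux BY NAME.
EVIDENCE / HONESTY: the chain's only T″ instance (E4″@G: `G = {X₀X₁ + X₂³ + X₃³ + X₄³}`, p = 2) IS a `singCentre` tower of height 2 from the point floor (floor 1 = Bl_𝔪 G, FULL,
singular along three compound-ODP curves = (Reg)ᶜ; floor 2 = blow-up of their reduced union, REGULAR — res-L1-w45a-stub-1, -2, -3, kernel row `tStepInstanceAt_G_origin` in flight);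
no other evidence; «iterate the blow-up of the worst POINT» is classically hopeless (Whitney umbrella; Kollár 2007 Ex. 3.6.1–3.6.2, Claim 3.6.3 «no iterative resolution algorithm
works one SMOOTH blow-up at a time») — the recipes here blow up the WHOLE reduced singular locus (a possibly singular centre), which those examples do not exclude, and the floors
are FULL (F-injective, Cohen–Macaulay) and regular off one fibre, which is a strong restriction; whether ANY Sing-supported recipe terminates on FULL germs of dimension ≥ 4 is OPEN
and is exactly what a kit tower engine can now test floor by floor (idea-1 / tri-2 engines compute Sing and blow-ups already). RR is kernel-STRONGER than T″ (so it cannot replace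
v41's stub — R18.7); its value is killability. Nothing of the crux is proved here.
[folklore assembly; cite: Temkin2008, Lemma 2.1.4] [cite: StacksProject, Tag 080B; Tag 02OS; Tag 02IS] [cite: Kollar2007, Ex. 3.6.1, Ex. 3.6.2, Claim 3.6.3]
-/

-- single-problem summit: the doubled namespace component is forced
set_option linter.dupNamespace false

noncomputable section

open AlgebraicGeometry CategoryTheory CategoryTheory.Limits Literature.AlgebraicGeometry.Resolution TopologicalSpace IsLocalRing

namespace Summit.ResolutionOfSingularities.ResolutionOfSingularities.Theorems.FInjectiveMacaulayfication.RegTower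

open Summit.ResolutionOfSingularities.ResolutionOfSingularities.Theorems.FInjectiveMacaulayfication
open SliceableCentre

/-! ## §1 Towers ending regular, for an arbitrary centre recipe -/

/-- `TowerRegular c p n S`: EVERY chain of `n` blowing ups, each along the recipe's centre `c p ·` of the floor below, starting at `S`, ends at a scheme that is REGULAR at every
point (blowing ups are unique up to unique isomorphism, so «every» = «the»). The recipe is any `c : ∀ p S, S.IdealSheafData` (= `IntrinsicTower.Recipes.CentreRecipe`). [OURS] -/
def TowerRegular (c : ∀ (_p : ℕ) (S : Scheme.{0}), S.IdealSheafData) (p : ℕ) : ℕ → Scheme.{0} → Prop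
  | 0 => fun S => ∀ s : S, s ∈ Scheme.regularLocus S
  | n + 1 => fun S => ∀ (S₁ : Scheme.{0}) (g : S₁ ⟶ S), IsBlowup g (c p S) → TowerRegular c p n S₁

/-- Floor zero of a regularizing tower: regular at every point. [OURS] -/
theorem towerRegular_zero {c : ∀ (_p : ℕ) (S : Scheme.{0}), S.IdealSheafData} {p : ℕ} {S : Scheme.{0}} :
    TowerRegular c p 0 S ↔ ∀ s : S, s ∈ Scheme.regularLocus S := Iff.rfl

/-- The successor floor of a regularizing tower. [OURS] -/
theorem towerRegular_succ {c : ∀ (_p : ℕ) (S : Scheme.{0}), S.IdealSheafData} {p n : ℕ} {S : Scheme.{0}} :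
    TowerRegular c p (n + 1) S ↔ ∀ (S₁ : Scheme.{0}) (g : S₁ ⟶ S), IsBlowup g (c p S) → TowerRegular c p n S₁ := Iff.rfl

/-- A tower of height zero that is regular IS a regular scheme (`Scheme.IsRegular` is pointwise regularity of stalks). [OURS] -/
theorem isRegular_of_towerRegular_zero {c : ∀ (_p : ℕ) (S : Scheme.{0}), S.IdealSheafData} {p : ℕ} {S : Scheme.{0}} (h : TowerRegular c p 0 S) :
    Scheme.IsRegular S := fun s => h s

/-! ## §2 The killable statement shape: T″'s binders verbatim, conclusion «the `c`-tower terminates REGULAR» -/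

/-- [OURS · CANDIDATE statement shape, KILLABLE per recipe] **(RR[c]) THE `c`-TOWER REGULARIZES.** Binders VERBATIM those of the T-half
`TrFullStep.LocalRegularizationFibreFullTr p e r` (a closed singular point `y` with FULL local ring of an integral separated finite-type `e`-fold `Y` over `k(X₁,…,X_r)`, an
ADMISSIBLE blowing up `S′ → Spec 𝒪_{Y,y}` along `I ≠ ⊥`, `supp I ⊆ (Reg)ᶜ`, regular off the closed fibre and FULL at every stalk); conclusion: for some `n`, the tower of `n`
blowing ups along the successive `c`-centres of `S′` ends REGULAR everywhere. ONE admissible FULL floor whose `c`-tower loops refutes it. -/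
def RegTowerTerminates (c : ∀ (_p : ℕ) (S : Scheme.{0}), S.IdealSheafData) (p e r : ℕ) : Prop :=
  ∀ (k : Type) [Field k] [CharP k p] (Y : Scheme.{0}) (g : Y ⟶ Spec (.of (FractionRing (MvPolynomial (Fin r) k)))),
    IsSeparated g → LocallyOfFiniteType g → QuasiCompact g → IsIntegral Y → topologicalKrullDim Y = e →
    ∀ y : Y, IsClosed ({y} : Set Y) → y ∉ Scheme.regularLocus Y → FullCl p (Y.presheaf.stalk y) →
      ∀ (S' : Scheme.{0}) (g' : S' ⟶ Spec (Y.presheaf.stalk y)) (I : (Spec (Y.presheaf.stalk y)).IdealSheafData),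
        I ≠ ⊥ → ((I.support : Set _) ⊆ (Scheme.regularLocus (Spec (Y.presheaf.stalk y)))ᶜ) → IsBlowup g' I →
        (∀ s : S', g'.base s ≠ closedPoint (Y.presheaf.stalk y) → s ∈ Scheme.regularLocus S') →
        (∀ s : S', FullCl p (S'.presheaf.stalk s)) →
        ∃ n : ℕ, TowerRegular c p n S'

/-! ## §3 One recipe: the reduced singular locus -/

/-- **THE RECIPE «Sing_red»**: the reduced (vanishing) ideal sheaf of the closure of the singular locus (for excellent schemes the singular locus is closed and the closure is
cosmetic). [OURS] -/
def singCentre : ∀ (_p : ℕ) (S : Scheme.{0}), S.IdealSheafData := fun _ S =>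
  Scheme.IdealSheafData.vanishingIdeal ⟨closure ((Scheme.regularLocus S)ᶜ), isClosed_closure⟩

/-- `singCentre` is Sing-supported (its support IS the closure of the singular locus). [OURS] -/
theorem support_singCentre_subset (p : ℕ) (S : Scheme.{0}) :
    ((singCentre p S).support : Set S) ⊆ closure ((Scheme.regularLocus S)ᶜ) := by
  simp only [singCentre, Scheme.IdealSheafData.coe_support_vanishingIdeal]
  exact subset_rfl

/-- [OURS · CANDIDATE statement, KILLABLE] **(RR-Sing) the reduced-singular-locus tower regularizes every FULL admissible floor** (T″'s binders; `∃ n`). Evidence: the chain's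
E4″@G instance has `singCentre`-tower height 2 from the point floor; nothing else. Open. -/
@[conjecture] def SingTowerConjecture (p e r : ℕ) : Prop := RegTowerTerminates singCentre p e r

/-! ## §4 The kernel bridge: RR[c] ⇒ T″ for every Sing-supported recipe (PROVED) -/

/-- **RR[c] ⇒ T″(p,e,r)** for every Sing-supported recipe `c`: from `FullCentreDescent.exists_regularCentre_of_tower` with `F` := the closed fibre of `S′ → Spec 𝒪_{Y,y}` —
closed (preimage of the closed point), missing a point (a preimage of the generic point `η`: `η ∈ Reg` by `genericPoint_mem_regularLocus`, so `η ∉ supp I` and the blowing up is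
an isomorphism over it; `η ≠` the closed point because `y ∉ Reg Y`, via `mem_regularLocus_iff_of_flat_of_isPreimmersion (Y.fromSpecStalk y)`), `S′` regular off `F` by the
binder; the conclusion «regular at every point of every blowing up along 𝓚» is `Scheme.IsRegular`. [folklore assembly; OURS] [cite: Temkin2008, Lemma 2.1.4]
[cite: StacksProject, Tag 080B; Tag 02OS; Tag 02IS] -/
theorem tStep_of_regTowerTerminates (c : ∀ (_p : ℕ) (S : Scheme.{0}), S.IdealSheafData)
    (hc : ∀ (p : ℕ) (S : Scheme.{0}), ((c p S).support : Set S) ⊆ closure ((Scheme.regularLocus S)ᶜ)) {p e r : ℕ}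
    (h : RegTowerTerminates c p e r) : TrFullStep.LocalRegularizationFibreFullTr p e r := by
  intro k _ _ Y g hs hl hq hi hd y hy hys hyfull S' g' I hI hIadm hg' hreg hfull
  classical
  haveI : IsLocallyNoetherian Y := by haveI := hl; exact LocallyOfFiniteType.isLocallyNoetherian g
  haveI : IsIntegral S' := hg'.isIntegral hI
  haveI : IsProper g' := hg'.isProper
  haveI : IsLocallyNoetherian S' := LocallyOfFiniteType.isLocallyNoetherian g'
  haveI : CompactSpace S' := QuasiCompact.compactSpace_of_compactSpace g'
  haveI : IsNoetherian S' := {}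
  obtain ⟨n, hn⟩ := h k Y g hs hl hq hi hd y hy hys hyfull S' g' I hI hIadm hg' hreg hfull
  -- the closed fibre
  let F : Set S' := {s | g'.base s = closedPoint (Y.presheaf.stalk y)}
  have hFcl : IsClosed F := by
    have hcp : IsClosed ({closedPoint (Y.presheaf.stalk y)} : Set (Spec (Y.presheaf.stalk y))) :=
      (PrimeSpectrum.isClosed_singleton_iff_isMaximal _).mpr (IsLocalRing.maximalIdeal.isMaximal _)
    exact hcp.preimage g'.continuous
  -- the generic point of `Spec 𝒪_{Y,y}` is regular, off `supp I`, and not the closed point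
  have hηreg : genericPoint (Spec (Y.presheaf.stalk y)) ∈ Scheme.regularLocus (Spec (Y.presheaf.stalk y)) :=
    genericPoint_mem_regularLocus _
  have hηI : genericPoint (Spec (Y.presheaf.stalk y)) ∉ (I.support : Set (Spec (Y.presheaf.stalk y))) := fun h' => hIadm h' hηreg
  have hηne : genericPoint (Spec (Y.presheaf.stalk y)) ≠ closedPoint (Y.presheaf.stalk y) := by
    intro hη
    apply hys
    haveI : Flat (Y.fromSpecStalk y) := flat_fromSpecStalk Y y
    have h' := (mem_regularLocus_iff_of_flat_of_isPreimmersion (Y.fromSpecStalk y) (closedPoint (Y.presheaf.stalk y))).mp (hη ▸ hηreg)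
    rwa [Scheme.fromSpecStalk_closedPoint] at h'
  -- `F` misses a point: a preimage of the generic point
  have hne : ∃ s : S', s ∉ F := by
    haveI := hg'.isIso_compl
    obtain ⟨s, hs'⟩ := RegularBlowupModelDim2.exists_preimage_of_isIso_morphismRestrict g'
      ⟨(I.support : Set (Spec (Y.presheaf.stalk y)))ᶜ, I.support.isClosed.isOpen_compl⟩ _ hηI
    exact ⟨s, fun h' => hηne (hs' ▸ h')⟩
  -- `S′` is regular off `F` (binder); descend the tower to ONE fibre-supported regularizing centre
  have hreg' : ∀ s : S', s ∉ F → s ∈ Scheme.regularLocus S' := fun s hs' => hreg s hs'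
  obtain ⟨𝓚, h𝓚ne, h𝓚F, h𝓚reg⟩ :=
    FullCentreDescent.exists_regularCentre_of_tower (TowerRegular c p) (c p) (hc p) (fun _ h0 => h0) (fun _ _ h1 => h1)
      n S' F hFcl hne hreg' hn
  exact ⟨𝓚, h𝓚ne, fun s hs' => h𝓚F s hs', fun S'' π hπ s => h𝓚reg S'' π hπ s⟩

/-- **RR-Sing ⇒ T″(p,e,r).** [OURS · conditional on `SingTowerConjecture`] -/
theorem tStep_of_singTowerConjecture {p e r : ℕ} (h : SingTowerConjecture p e r) : TrFullStep.LocalRegularizationFibreFullTr p e r :=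
  tStep_of_regTowerTerminates singCentre support_singCentre_subset h

/-! ## §5 Door terms (a candidate line «TWO TOWERS», by evidence only — NO door change) -/

/-- crux ⟸ four published theorems ∧ the F-half ∧ (RR[c] at `r = 1`, every `e ≥ 4`, for ONE Sing-supported recipe `c`) — door v41's deciding term with the T-half supplied by
the regularizing tower. [OURS · conditional] -/
theorem fInjectiveMacaulayfication_of_prints_of_LFadmF_of_regTower (c : ∀ (_p : ℕ) (S : Scheme.{0}), S.IdealSheafData)
    (hc : ∀ (p : ℕ) (S : Scheme.{0}), ((c p S).support : Set S) ⊆ closure ((Scheme.regularLocus S)ᶜ))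
    (hG : CossartPiltant2019General.{0}) (h081R : Stacks081R.{0}) (hP : CossartPiltant2019Principalization.{0})
    (hM : CesnaviciusBlowupMacaulayficationOffClosed.{0})
    (hF : LocalFullificationFibreAdmGe4Split.LocalFInjectivizationFibreAdmGe4)
    (hRR : ∀ p e : ℕ, p.Prime → 4 ≤ e → RegTowerTerminates c p e 1) :
    Summit.ResolutionOfSingularities.ResolutionOfSingularities.Theses.FrobeniusLadder.FInjectiveMacaulayfication :=
  TrFullStepDoor.fInjectiveMacaulayfication_of_prints_of_LFadmF_of_tStepOne hG h081R hP hM hF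
    (fun p e hp he => tStep_of_regTowerTerminates c hc (hRR p e hp he))

/-- crux ⟸ four published theorems ∧ the F-half ∧ `SingTowerConjecture p e 1` for every prime `p` and every `e ≥ 4`. [OURS · conditional] -/
theorem fInjectiveMacaulayfication_of_prints_of_LFadmF_of_singTower
    (hG : CossartPiltant2019General.{0}) (h081R : Stacks081R.{0}) (hP : CossartPiltant2019Principalization.{0})
    (hM : CesnaviciusBlowupMacaulayficationOffClosed.{0})
    (hF : LocalFullificationFibreAdmGe4Split.LocalFInjectivizationFibreAdmGe4)
    (hRR : ∀ p e : ℕ, p.Prime → 4 ≤ e → SingTowerConjecture p e 1) :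
    Summit.ResolutionOfSingularities.ResolutionOfSingularities.Theses.FrobeniusLadder.FInjectiveMacaulayfication :=
  fInjectiveMacaulayfication_of_prints_of_LFadmF_of_regTower singCentre support_singCentre_subset hG h081R hP hM hF hRR


/-- ★ **THE TWIN-TOWERS DOOR TERM (line v43, by evidence only; R19.8a (3′))**: crux ⟸ four published theorems ∧ `IntrinsicTower.Recipes.TauTowerConjecture` (the rad-τ
tower FULL-ifies every admissible CM floor) ∧ `SingTowerConjecture p e 1` for every prime `p` and every `e ≥ 4` (the Sing_red tower regularizes every admissible FULL floor) —
v41's `TrFullStepDoor` term with BOTH halves supplied by canonical, computation-refutable tower statements. [OURS · conditional] -/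
theorem fInjectiveMacaulayfication_of_prints_of_twinTowers
    (hG : CossartPiltant2019General.{0}) (h081R : Stacks081R.{0}) (hP : CossartPiltant2019Principalization.{0})
    (hM : CesnaviciusBlowupMacaulayficationOffClosed.{0})
    (hTT : IntrinsicTower.Recipes.TauTowerConjecture)
    (hRR : ∀ p e : ℕ, p.Prime → 4 ≤ e → SingTowerConjecture p e 1) :
    Summit.ResolutionOfSingularities.ResolutionOfSingularities.Theses.FrobeniusLadder.FInjectiveMacaulayfication :=
  IntrinsicTower.Recipes.fInjectiveMacaulayfication_of_prints_of_tauTower_of_tStepOne hG h081R hP hM hTT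
    (fun p e hp he => tStep_of_singTowerConjecture (hRR p e hp he))

end Summit.ResolutionOfSingularities.ResolutionOfSingularities.Theorems.FInjectiveMacaulayfication.RegTower

end
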